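import Summits.Ventures.HSemireg.WedgeHankelRecurrenceLinearComplexity
import Summits.Ventures.HSemireg.WedgeHankelRecurrenceCensus

/-!
# Venture HSemireg — EVERY CLASS HAS LINEAR COMPLEXITY `R` OR `N + 2 − R`, and THE LINEAR COMPLEXITY CENSUS (Gustavson 1976 ∕ Rueppel 1986): over a field with `s` elements, **exactly
# `(s − 1)·s^{min(2ℓ − 1, 2(N + 1) − 2ℓ)}` sequences `q_0, …, q_N` have linear complexity `ℓ`** (`1 ≤ ℓ ≤ N + 1`; one sequence, `0`, has `ℓ = 0`) — the affine classes of middle rank `ℓ` when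
# `2ℓ ≤ N + 1`, the polar classes of rank `N + 2 − ℓ` when `2ℓ ≥ N + 3`, the generic classes when `2ℓ = N + 2`, counted by N44

HONEST FRAMING. Part of the Lean index of the computation cell `pub-hsemireg` (seat p10 gen 30, Sunday typer «UNIFORM-IN-n»).
LINEAR ALGEBRA OF HANKEL (catalecticant) MATRICES and of polynomials over a field ONLY: no variety, no cohomology theory, no sheaf, no Ext group and no semiregularity map is constructed
here; nothing here says that HC / HC_CM / HC_AV holds; no Literature fact is declared or used.  Custodian versions as in `WedgeHankelSiegelIdeal` (1/3); the dictionary («linear complexity of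
a finite sequence», Massey 1969; «the number of sequences of length `n` over `F_s` with linear complexity `L` is `(s − 1) s^{min(2L−1, 2n−2L)}`», Gustavson 1976, Rueppel 1986 Ch. 4) is QUOTED in
docstrings, never asserted; as in N70, «`q` has linear complexity `ℓ`» is `IsLeast {k | ∃ p ∈ Rec_k(q), p ≠ 0 ∧ deg p = k} ℓ`, no definition.

WHAT IS IN THE TREE / CHAINED.  N70 (`WedgeHankelRecurrenceLinearComplexity`): `isLeast_setOf_lfsr_of_isAffineClass` (`L = r`), `isLeast_setOf_lfsr_of_isPolarClass` (`L = N + 2 − r`), `isLeast_setOf_lfsr_top`,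
`rank_half_le_of_mem_setOf_lfsr`; N44 (`WedgeHankelRecurrenceCensus`, № 326): `seqOf`, `ncard_setOf_isAffineClass` (`(s − 1)s^{2r−1}`), `ncard_setOf_isPolarClass` (`(s − 1)s^{2r−2}`),
`ncard_setOf_rank_half_eq_top` (`(s − 1)s^{2t}`), `ncard_setOf_isAffineClass_zero` (`1`); N43 (№ 323) `isAffineClass_or_isPolarClass`, `IsAffineClass.not_isPolarClass`, `isAffineClass_zero_iff`; N59 (№ 386)
`exists_basis_recSpace_top`; N17 (№ 156) `rank_hankel1_half_eq_zero_iff`.  Mathlib: `IsLeast.unique`, `Matrix.rank_le_height`.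
THIS FILE (namespace `Summit.Ventures.HSemireg.Wedge.HankelOuter` continued; CHAINED on N70 (N44 in the tree); 0 definitions).  `S^N(q) := {k | ∃ p ∈ Rec^N_k(q), p ≠ 0 ∧ deg p = k}` inline.
* §620 **`IsPolarClass.add_le_succ`** (a polar class has `2r ≤ N + 1`: at the top rank of an even level there is a full-degree generator, N59), **`exists_isLeast_setOf_lfsr`** (EVERY `q` on EVERY
  `[0, N]`, every field: the linear complexity exists and is `R^N(q)` (affine) or `N + 2 − R^N(q)` (polar)), `isLeast_setOf_lfsr_le_succ` (`L ≤ N + 1`), `rank_half_le_of_isLeast_setOf_lfsr` (`R ≤ L`).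
* §621 THE LEVEL SETS: `setOf_isLeast_lfsr_eq_of_le` (`1 ≤ ℓ`, `2ℓ ≤ N + 1`: `{L = ℓ}` = the affine classes of rank `ℓ`), `setOf_isLeast_lfsr_eq_of_ge` (`ℓ ≤ N + 1`, `2ℓ ≥ N + 3`: the polar classes of
  rank `N + 2 − ℓ`), `setOf_isLeast_lfsr_eq_top` (`N = 2t`, `ℓ = t + 1`: the classes of top rank), `setOf_isLeast_lfsr_eq_zero` (`ℓ = 0`: the zero class).
* §622 THE CENSUS (`[Finite K]`, `s = #K`): `ncard_setOf_isLeast_lfsr_of_le` (`(s − 1)s^{2ℓ−1}`), `ncard_setOf_isLeast_lfsr_of_ge` (`(s − 1)s^{2(N+1−ℓ)}`), `ncard_setOf_isLeast_lfsr_top` (`(s − 1)s^{2t}`),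
  `ncard_setOf_isLeast_lfsr_zero` (`1`), and RUEPPEL'S FORMULA **`ncard_setOf_isLeast_lfsr`** (`1 ≤ ℓ ≤ N + 1`: `(s − 1)·s^{min(2ℓ−1, 2(N+1)−2ℓ)}`).
Nothing Ext-side.  New names only.
-/

open Module Polynomial
open scoped Matrix Polynomial

namespace Summit.Ventures.HSemireg.Wedge.HankelOuter

open Summit.Ventures.HSemireg.Wedge Summit.Ventures.HSemireg.Wedge.Hankel

variable (K : Type*) [Field K] {N : ℕ}

/-! ## §620. Every class has linear complexity `R` or `N + 2 − R` -/

/-- **A POLAR CLASS LIES INSIDE THE WINDOW: `IsPolarClass K N r q ⇒ 2r ≤ N + 1`** (`r ≤ ⌊N/2⌋ + 1`; at the top rank `t + 1` of an even level `2t` the minimal window `Rec_{t+1}(q)` contains a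
generator of full degree `t + 1`, N59, so the class is affine there). -/
theorem IsPolarClass.add_le_succ {r : ℕ} {q : ℕ → K} (hP : IsPolarClass K N r q) : r + r ≤ N + 1 := by
  by_contra hlt
  have hrle : r ≤ N / 2 + 1 := hP.rank_eq ▸ Matrix.rank_le_height _
  obtain ⟨t, ht | ht⟩ : ∃ t, N = t + t ∨ N = t + t + 1 := ⟨N / 2, by omega⟩
  · subst ht
    have hr : r = t + 1 := by omega
    subst hr
    obtain ⟨-, g₂, -, -, -, hg₂, hg₂d, -⟩ := exists_basis_recSpace_top K hP.rank_eq
    have hg₂0 : g₂ ≠ 0 := fun h => by rw [h, Polynomial.natDegree_zero] at hg₂d; omega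
    have := hP.2 g₂ hg₂ hg₂0
    omega
  · omega

/-- **EVERY CLASS ON EVERY `[0, N]` HAS A LINEAR COMPLEXITY, EQUAL TO `R^N(q)` (AFFINE class) OR TO `N + 2 − R^N(q)` (POLAR class)** — every field. -/
theorem exists_isLeast_setOf_lfsr (q : ℕ → K) : ∃ L : ℕ, IsLeast {k : ℕ | ∃ p ∈ recSpace K N q k, p ≠ 0 ∧ p.natDegree = k} L ∧
    ((IsAffineClass K N (hankel1 K N (N / 2) q).rank q ∧ L = (hankel1 K N (N / 2) q).rank) ∨
      (IsPolarClass K N (hankel1 K N (N / 2) q).rank q ∧ L = N + 2 - (hankel1 K N (N / 2) q).rank)) := by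
  rcases isAffineClass_or_isPolarClass K (rfl : (hankel1 K N (N / 2) q).rank = _) with hA | hP
  · exact ⟨_, isLeast_setOf_lfsr_of_isAffineClass K hA, Or.inl ⟨hA, rfl⟩⟩
  · exact ⟨_, isLeast_setOf_lfsr_of_isPolarClass K hP (hP.add_le_succ K), Or.inr ⟨hP, rfl⟩⟩

/-- the linear complexity is at most `N + 1`. -/
theorem isLeast_setOf_lfsr_le_succ {q : ℕ → K} {L : ℕ} (hL : IsLeast {k : ℕ | ∃ p ∈ recSpace K N q k, p ≠ 0 ∧ p.natDegree = k} L) : L ≤ N + 1 :=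
  hL.2 (succ_level_mem_setOf_lfsr K q)

/-- … and at least the middle rank. -/
theorem rank_half_le_of_isLeast_setOf_lfsr {q : ℕ → K} {L : ℕ} (hL : IsLeast {k : ℕ | ∃ p ∈ recSpace K N q k, p ≠ 0 ∧ p.natDegree = k} L) : (hankel1 K N (N / 2) q).rank ≤ L :=
  rank_half_le_of_mem_setOf_lfsr K hL.1

/-! ## §621. The level sets of the linear complexity -/

/-- **`1 ≤ ℓ`, `2ℓ ≤ N + 1`: the classes of linear complexity `ℓ` are exactly the AFFINE classes of middle rank `ℓ`** (a polar class of rank `r` has `L = N + 2 − r ≥ (N + 3)/2`). -/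
theorem setOf_isLeast_lfsr_eq_of_le {l : ℕ} (h2 : l + l ≤ N + 1) :
    {v : Fin (N + 1) → K | IsLeast {k : ℕ | ∃ p ∈ recSpace K N (seqOf K v) k, p ≠ 0 ∧ p.natDegree = k} l} = {v : Fin (N + 1) → K | IsAffineClass K N l (seqOf K v)} := by
  ext v
  simp only [Set.mem_setOf_eq]
  constructor
  · intro hL
    obtain ⟨L', hL', hcase⟩ := exists_isLeast_setOf_lfsr K (N := N) (seqOf K v)
    have hLL : l = L' := hL.unique hL'
    rcases hcase with ⟨hA, hAL⟩ | ⟨hP, hPL⟩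
    · rw [hLL, hAL]; exact hA
    · have := hP.add_le_succ K; omega
  · exact fun hA => isLeast_setOf_lfsr_of_isAffineClass K hA

/-- **`ℓ ≤ N + 1`, `2ℓ ≥ N + 3`: the classes of linear complexity `ℓ` are exactly the POLAR classes of middle rank `N + 2 − ℓ`** (an affine class has `L = r ≤ ⌊N/2⌋ + 1`). -/
theorem setOf_isLeast_lfsr_eq_of_ge {l : ℕ} (hl : l ≤ N + 1) (h2 : N + 3 ≤ l + l) :
    {v : Fin (N + 1) → K | IsLeast {k : ℕ | ∃ p ∈ recSpace K N (seqOf K v) k, p ≠ 0 ∧ p.natDegree = k} l} = {v : Fin (N + 1) → K | IsPolarClass K N (N + 2 - l) (seqOf K v)} := by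
  ext v
  simp only [Set.mem_setOf_eq]
  constructor
  · intro hL
    obtain ⟨L', hL', hcase⟩ := exists_isLeast_setOf_lfsr K (N := N) (seqOf K v)
    have hLL : l = L' := hL.unique hL'
    rcases hcase with ⟨hA, hAL⟩ | ⟨hP, hPL⟩
    · have hrle : (hankel1 K N (N / 2) (seqOf K v)).rank ≤ N / 2 + 1 := Matrix.rank_le_height _
      omega
    · have h2r := hP.add_le_succ K
      rwa [show N + 2 - l = (hankel1 K N (N / 2) (seqOf K v)).rank by omega]
  · intro hP
    have h := isLeast_setOf_lfsr_of_isPolarClass K hP (by omega)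
    rwa [show N + 2 - (N + 2 - l) = l by omega] at h

/-- **`N = 2t`, `ℓ = t + 1`: the classes of linear complexity `t + 1` on `[0, 2t]` are exactly the classes of TOP middle rank `t + 1`** (affine of rank `t + 1`; a polar class of rank `r ≤ t` has
`L = 2t + 2 − r ≥ t + 2`). -/
theorem setOf_isLeast_lfsr_eq_top (t : ℕ) :
    {v : Fin (2 * t + 1) → K | IsLeast {k : ℕ | ∃ p ∈ recSpace K (2 * t) (seqOf K v) k, p ≠ 0 ∧ p.natDegree = k} (t + 1)}
      = {v : Fin (2 * t + 1) → K | (hankel1 K (2 * t) (2 * t / 2) (seqOf K v)).rank = t + 1} := by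
  ext v
  simp only [Set.mem_setOf_eq]
  constructor
  · intro hL
    obtain ⟨L', hL', hcase⟩ := exists_isLeast_setOf_lfsr K (N := 2 * t) (seqOf K v)
    have hLL : t + 1 = L' := hL.unique hL'
    rcases hcase with ⟨hA, hAL⟩ | ⟨hP, hPL⟩
    · rw [hLL, hAL]
    · have h2r := hP.add_le_succ K
      omega
  · intro hq
    have hq' : (hankel1 K (t + t) ((t + t) / 2) (seqOf K v)).rank = t + 1 := by rwa [← two_mul]
    have h := isLeast_setOf_lfsr_top K hq'
    rwa [← two_mul] at h

/-- **`ℓ = 0`: linear complexity `0` means the zero class** (a non-zero constant recurrence of the empty window kills every `q_j`, `j ≤ N`). -/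
theorem setOf_isLeast_lfsr_eq_zero (N : ℕ) :
    {v : Fin (N + 1) → K | IsLeast {k : ℕ | ∃ p ∈ recSpace K N (seqOf K v) k, p ≠ 0 ∧ p.natDegree = k} 0} = {v : Fin (N + 1) → K | IsAffineClass K N 0 (seqOf K v)} :=
  setOf_isLeast_lfsr_eq_of_le K (Nat.zero_le _)

/-! ## §622. The census of linear complexities over a finite field (Gustavson–Rueppel) -/

/-- **`#{q on [0, N] | L(q) = ℓ} = (s − 1)·s^{2ℓ−1}` for `1 ≤ ℓ`, `2ℓ ≤ N + 1`** (N44's affine classes of rank `ℓ`). -/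
theorem ncard_setOf_isLeast_lfsr_of_le [Finite K] {l : ℕ} (hl : 1 ≤ l) (h2 : l + l ≤ N + 1) :
    {v : Fin (N + 1) → K | IsLeast {k : ℕ | ∃ p ∈ recSpace K N (seqOf K v) k, p ≠ 0 ∧ p.natDegree = k} l}.ncard = (Nat.card K - 1) * Nat.card K ^ (2 * l - 1) := by
  rw [setOf_isLeast_lfsr_eq_of_le K h2, ncard_setOf_isAffineClass K hl h2]

/-- **`#{q on [0, N] | L(q) = ℓ} = (s − 1)·s^{2(N + 1 − ℓ)}` for `ℓ ≤ N + 1`, `2ℓ ≥ N + 3`** (N44's polar classes of rank `N + 2 − ℓ`). -/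
theorem ncard_setOf_isLeast_lfsr_of_ge [Finite K] {l : ℕ} (hl : l ≤ N + 1) (h2 : N + 3 ≤ l + l) :
    {v : Fin (N + 1) → K | IsLeast {k : ℕ | ∃ p ∈ recSpace K N (seqOf K v) k, p ≠ 0 ∧ p.natDegree = k} l}.ncard = (Nat.card K - 1) * Nat.card K ^ (2 * (N + 1 - l)) := by
  rw [setOf_isLeast_lfsr_eq_of_ge K hl h2, ncard_setOf_isPolarClass K (by omega) (by omega), show 2 * (N + 2 - l) - 2 = 2 * (N + 1 - l) by omega]

/-- **`#{q on [0, 2t] | L(q) = t + 1} = (s − 1)·s^{2t}`** (N44's classes of top rank). -/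
theorem ncard_setOf_isLeast_lfsr_top [Finite K] (t : ℕ) :
    {v : Fin (2 * t + 1) → K | IsLeast {k : ℕ | ∃ p ∈ recSpace K (2 * t) (seqOf K v) k, p ≠ 0 ∧ p.natDegree = k} (t + 1)}.ncard = (Nat.card K - 1) * Nat.card K ^ (2 * t) := by
  rw [setOf_isLeast_lfsr_eq_top K t, ncard_setOf_rank_half_eq_top K t]

/-- **`#{q on [0, N] | L(q) = 0} = 1`** (the zero class). -/
theorem ncard_setOf_isLeast_lfsr_zero (N : ℕ) :
    {v : Fin (N + 1) → K | IsLeast {k : ℕ | ∃ p ∈ recSpace K N (seqOf K v) k, p ≠ 0 ∧ p.natDegree = k} 0}.ncard = 1 := by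
  rw [setOf_isLeast_lfsr_eq_zero K N, ncard_setOf_isAffineClass_zero]

/-- **THE LINEAR COMPLEXITY CENSUS (Gustavson–Rueppel): over a field with `s` elements and for `1 ≤ ℓ ≤ N + 1`, exactly `(s − 1)·s^{min(2ℓ − 1, 2(N + 1) − 2ℓ)}` of the `s^{N+1}` sequences
`q_0, …, q_N` have linear complexity `ℓ`** (the three regimes `2ℓ ≤ N + 1` ∕ `2ℓ = N + 2` ∕ `2ℓ ≥ N + 3` of §621). -/
theorem ncard_setOf_isLeast_lfsr [Finite K] {l : ℕ} (hl : 1 ≤ l) (hlN : l ≤ N + 1) :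
    {v : Fin (N + 1) → K | IsLeast {k : ℕ | ∃ p ∈ recSpace K N (seqOf K v) k, p ≠ 0 ∧ p.natDegree = k} l}.ncard
      = (Nat.card K - 1) * Nat.card K ^ min (2 * l - 1) (2 * (N + 1) - 2 * l) := by
  rcases Nat.lt_or_ge (N + 1) (l + l) with hgt | hle
  · rcases Nat.lt_or_ge (N + 2) (l + l) with hgt' | hle'
    · rw [ncard_setOf_isLeast_lfsr_of_ge K hlN (by omega), show min (2 * l - 1) (2 * (N + 1) - 2 * l) = 2 * (N + 1 - l) by omega]
    · -- `2ℓ = N + 2`: the even level `N = 2t`, `ℓ = t + 1`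
      obtain ⟨t, rfl⟩ : ∃ t, l = t + 1 := ⟨l - 1, by omega⟩
      have hN : N = 2 * t := by omega
      subst hN
      rw [ncard_setOf_isLeast_lfsr_top K t, show min (2 * (t + 1) - 1) (2 * (2 * t + 1) - 2 * (t + 1)) = 2 * t by omega]
  · rw [ncard_setOf_isLeast_lfsr_of_le K hl hle, show min (2 * l - 1) (2 * (N + 1) - 2 * l) = 2 * l - 1 by omega]

end Summit.Ventures.HSemireg.Wedge.HankelOuter
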